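import Literature.MathematicalPhysics.QuantumFieldTheory.Balaban1983to89.B9Thm315WholeSectE

/-!
# `Balaban1983to89.B9Thm315WholeSectEExpansion` — [B9] Theorem 3.15 (p. 432): def-Y's located (O2″) «C^{(k)}(Λ; U) = Σ_ω T_ω(U) on the index-bond
# carrier» TYPED as an eventual kernelwise identity, and the seat's reading `KernelDominated` (FILE `B9Thm315WholeSectE`) DERIVED from it

T. Bałaban, *Propagators for lattice gauge theories in a background field*, Commun. Math. Phys. **99** (1985) 389–434
[`Balaban1985BackgroundPropagators`, "B9"].

statement-level skeleton of published theorems with citation tags; proofs where landed; nothing here is a claim about the Yang–Mills mass gap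

THE PRINTED LOCUS (verbatim, p. 432 [PDF 44]).  *"Now let us consider the operators G₂ and (Q̃G₂Q̃*)⁻¹. The operator G₂ has the same properties as G, …
hence we can apply to it the results of Sect. C, especially Theorem 3.7 holds. Similarly Theorem 3.9 can be extended to the operator (Q̃G₂Q̃*)⁻¹.
Expanding these into random walks we get a random walk expansion of C^{(k)}(Λ). … This propagator has a convergent random walk expansion of the type
described previously."*  Thm 3.9 p. 413: *"(Q′G′²Q′*)⁻¹ = Σ_ω R′₀(X₀)R′_{α₁}(X₁)·⋯·R′_{αₙ}(Xₙ) (3.98) … |(R′₀(X₀)⋯R′_{αₙ}(Xₙ))(y, y′)| ≤ … (3.99)"* —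
an OPERATOR identity, the kernel bound read off term by term.

THE POINT.  `B9Thm315WholeSectE` (p501218) proves row 24's bound (3.187) from the pinned expansion slot `hasRWExpCY` and ONE located reading,
`KernelDominated (𝔴 x).EC Ck (inΛY x) (W x) U`: «for y, y′ ∈ Λ the kernel entry |C^{(k)}(Λ; U; y, y′)| is at most every uniform bound of the partial sums
Σ_{k<m}Σ_{ω∈W k y y′}|kterm(U; ω; y, y′)|».  def-Y's `Node00.OpsYSectE` locates the supplier's form of that reading as (O2″): *the operator-level
identity `C^{(k)}(Λ; U) = Σ_ω T_ω(U)` on the index-bond carrier*.  THIS FILE types (O2″) and proves the implication, so the supplier's obligation is an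
operator-series statement about letters, not an inequality schema:
* §1 `KTermReadsY 𝔴 T U` — THE PIN between the walk letter's real terms and operator-valued walk terms `T ω : U ↦ End(IBondY → 𝔸)`: the kernel entry of
  `T_ω(U)` at `(y, y′)` in every unit direction is at most `|kterm(U; ω; y, y′)|` (how a kernel expansion's `kterm` is MEANT, (3.99));
  `KExpansionReadsY x 𝔏 𝔢 𝔴 T W U` — (O2″) AS AN EVENTUAL KERNELWISE IDENTITY: for `y, y′ ∈ Λ`, every direction `E` (‖E‖ ≤ 1) and every ε > 0, for all
  large m, `‖(C^{(k)}(Λ; U)(δ_{y′} ⊗ E))(y) − Σ_{k<m}Σ_{ω∈W k y y′}(T_ω(U)(δ_{y′} ⊗ E))(y)‖ ≤ ε` («the expansion converges to the operator», kernelwise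
  on the finite lattice).
* §2 ★★ `kernelDominated_of_kExpansionReads` — `KTermReadsY` + `KExpansionReadsY` ⇒ `KernelDominated (𝔴 x).EC (siteKernelOfOp … (CkY x 𝔏 𝔢) id id) (inΛY x)
  W U` (triangle inequality under the sum, then «limits keep bounds» and the sup over the unit ball, `Node00.iSup_ball_le`); ★ `hread_of_kExpansionReads` —
  the `hread` binder of `B9Thm315WholeSectE.thm315FullPrinted_sectE_of_reading` ∕ `t315_opsYSectE_of_reading` ∕ `…RecordES…` ∕ `…RecordV4E…` in the
  supplier's currency: `∀ x U, (𝔴 x).EC.Converges U → KTermReadsY (𝔴 x) (T x) U ∧ KExpansionReadsY x (𝔏 x) (𝔢 x) (𝔴 x) (T x) (W x) U`.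

HONEST SCOPE.  Count-neutral kernel bookkeeping (ε-arithmetic on a finite lattice); the identity (O2″) itself — the random walk expansion of
`C^{(k)}(Λ)` obtained by inserting the Sect. C expansions of `G₂` and `(Q̃G₂Q̃*)⁻¹` into (3.185) — stays a DISPLAYED hypothesis on def-Y's letters (its
construction needs the Sect. E letters of record and typed Sect. C expansions; GAPS G-B9-10).  Nothing of print asserted; NOT a node discharge (N06
unmoved), NOT summit progress; one finite lattice programme at fixed ε; nothing continuum ∕ ℝ⁴ ∕ OS ∕ mass gap ∕ Clay.  Cell `pub-ymgap` (D-0062), node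
N06 [B9], N06-ASSIGNMENT bundle F8 row 24 (successor file), seat `pub-ymgap-dag-n06-m` (g4), 2026-08-27.  Imports the seat's `B9Thm315WholeSectE`; nothing
restated.  Net new unproved facts: 0.
-/

noncomputable section

namespace Literature.MathematicalPhysics.QuantumFieldTheory.Balaban1983to89.B9Thm315WholeSectEExpansion

open B9 Node00
open B6KLevelCensusIndexV1 (KIdx)
open B9PinMembersKLevelV1 (MemberY geo9Y bg9Y)
open B9PinGeometryKLevelV1 (inΛY unitDistY c35Y)
open B9Thm315WholeSectE (KernelDominated)

variable {d ℓ : ℕ} {hd : 1 ≤ d + 1} {hL : Odd (ℓ + 1) ∧ 1 < ℓ + 1} {b₀ b₁ : ℝ} {Mstar : ℕ}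
variable {𝔸 : Type} [NormedRing 𝔸] [NormedAlgebra ℂ 𝔸] [CompleteSpace 𝔸] {G : Subgroup 𝔸ˣ}

/-! ## §1 (O2″) typed: operator-valued walk terms, the pin to `kterm`, the eventual kernelwise identity -/

section Schemas

variable {x : MemberY d ℓ hd hL b₀ b₁ Mstar}

/-- ★ **THE PIN BETWEEN THE WALK LETTER'S TERMS AND OPERATOR-VALUED WALK TERMS** at `U`: for every walk `ω`, all index bonds `y, y′` and every direction
`E` with `‖E‖ ≤ 1`, `‖(T_ω(U)(δ_{y′} ⊗ E))(y)‖ ≤ |kterm(U; ω; y, y′)|` — the real term of r1's `RWKernelExpansion` IS (a bound of) the kernel entry of the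
ω-term of the operator expansion ((3.98)–(3.99): the bound is stated for `|(R′₀(X₀)⋯R′_{αₙ}(Xₙ))(y, y′)|`).  A hypothesis schema on the supplier's letters.
[cite: Balaban1985BackgroundPropagators, Thm 3.9 (3.98)–(3.99) p.413, Thm 3.15 p.432] -/
def KTermReadsY (𝔴 : RWLettersEY 𝔸 G x) (T : 𝔴.EC.Walk → IBondOpY 𝔸 x.toKIdx) (U : CfgY 𝔸 x.toKIdx) : Prop :=
  ∀ (ω : 𝔴.EC.Walk) (y y' : IBondY x.toKIdx) (E : BallY 𝔸), ‖T ω U (deltaY y' (E : 𝔸)) y‖ ≤ |𝔴.EC.kterm U ω y y'|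

variable (x) in
/-- ★★ **def-Y's (O2″) «C^{(k)}(Λ; U) = Σ_ω T_ω(U)» AS AN EVENTUAL KERNELWISE IDENTITY ON Λ**: for `y, y′ ∈ Λ`, every direction `E` (‖E‖ ≤ 1) and every
`ε > 0` there is `m₀` with `‖(C^{(k)}(Λ; U)(δ_{y′} ⊗ E))(y) − Σ_{k<m}Σ_{ω ∈ W k y y′}(T_ω(U)(δ_{y′} ⊗ E))(y)‖ ≤ ε` for all `m ≥ m₀` — the random walk
expansion of `C^{(k)}(Λ)` (print: insert the Sect. C expansions of `G₂`, `(Q̃G₂Q̃*)⁻¹` into (3.185)) converges to the operator, read kernelwise over the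
walk sets.  A hypothesis schema on def-Y's letters; nothing asserted. [cite: Balaban1985BackgroundPropagators, Thm 3.15 p.432 («Expanding these into random walks we get a random walk expansion of C^{(k)}(Λ)»), Thm 3.9 (3.98) p.413] -/
def KExpansionReadsY (𝔏 : CovLettersY 𝔸 x) (𝔢 : SectELettersY 𝔸 x) (𝔴 : RWLettersEY 𝔸 G x) (T : 𝔴.EC.Walk → IBondOpY 𝔸 x.toKIdx)
    (W : ℕ → IBondY x.toKIdx → IBondY x.toKIdx → Finset 𝔴.EC.Walk) (U : CfgY 𝔸 x.toKIdx) : Prop :=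
  ∀ y y' : IBondY x.toKIdx, inΛY x y → inΛY x y' → ∀ (E : BallY 𝔸) (ε : ℝ), 0 < ε → ∃ m₀ : ℕ, ∀ m, m₀ ≤ m →
    ‖CkY x 𝔏 𝔢 U (deltaY y' (E : 𝔸)) y - ∑ k ∈ Finset.range m, ∑ ω ∈ W k y y', T ω U (deltaY y' (E : 𝔸)) y‖ ≤ ε

/-- the pin unfolded. [cite: Balaban1985BackgroundPropagators, Thm 3.9 (3.99) p.413, bookkeeping] -/
theorem kTermReadsY_iff (𝔴 : RWLettersEY 𝔸 G x) (T : 𝔴.EC.Walk → IBondOpY 𝔸 x.toKIdx) (U : CfgY 𝔸 x.toKIdx) :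
    KTermReadsY 𝔴 T U ↔
      ∀ (ω : 𝔴.EC.Walk) (y y' : IBondY x.toKIdx) (E : BallY 𝔸), ‖T ω U (deltaY y' (E : 𝔸)) y‖ ≤ |𝔴.EC.kterm U ω y y'| := Iff.rfl

/-- (O2″) unfolded. [cite: Balaban1985BackgroundPropagators, Thm 3.15 p.432, bookkeeping] -/
theorem kExpansionReadsY_iff (𝔏 : CovLettersY 𝔸 x) (𝔢 : SectELettersY 𝔸 x) (𝔴 : RWLettersEY 𝔸 G x) (T : 𝔴.EC.Walk → IBondOpY 𝔸 x.toKIdx)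
    (W : ℕ → IBondY x.toKIdx → IBondY x.toKIdx → Finset 𝔴.EC.Walk) (U : CfgY 𝔸 x.toKIdx) :
    KExpansionReadsY x 𝔏 𝔢 𝔴 T W U ↔
      ∀ y y' : IBondY x.toKIdx, inΛY x y → inΛY x y' → ∀ (E : BallY 𝔸) (ε : ℝ), 0 < ε → ∃ m₀ : ℕ, ∀ m, m₀ ≤ m →
        ‖CkY x 𝔏 𝔢 U (deltaY y' (E : 𝔸)) y - ∑ k ∈ Finset.range m, ∑ ω ∈ W k y y', T ω U (deltaY y' (E : 𝔸)) y‖ ≤ ε := Iff.rfl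

end Schemas

/-! ## §2 (O2″) ⇒ the reading `KernelDominated` -/

section Reading

variable {x : MemberY d ℓ hd hL b₀ b₁ Mstar} {𝔏 : CovLettersY 𝔸 x} {𝔢 : SectELettersY 𝔸 x} {𝔴 : RWLettersEY 𝔸 G x}
  {T : 𝔴.EC.Walk → IBondOpY 𝔸 x.toKIdx} {W : ℕ → IBondY x.toKIdx → IBondY x.toKIdx → Finset 𝔴.EC.Walk} {U : CfgY 𝔸 x.toKIdx}

/-- one direction, one truncation: `‖(C^{(k)}(δ_{y′} ⊗ E))(y)‖ ≤ Σ_{k<m}Σ_ω |kterm| + ‖C^{(k)}(δ_{y′} ⊗ E)(y) − Σ_{k<m}Σ_ω T_ω(δ_{y′} ⊗ E)(y)‖`.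
[cite: Balaban1985BackgroundPropagators, Thm 3.9 (3.98)–(3.99) p.413, bookkeeping] -/
theorem norm_CkY_deltaY_le (hT : KTermReadsY 𝔴 T U) (y y' : IBondY x.toKIdx) (E : BallY 𝔸) (m : ℕ) :
    ‖CkY x 𝔏 𝔢 U (deltaY y' (E : 𝔸)) y‖ ≤
      (∑ k ∈ Finset.range m, ∑ ω ∈ W k y y', |𝔴.EC.kterm U ω y y'|) +
        ‖CkY x 𝔏 𝔢 U (deltaY y' (E : 𝔸)) y - ∑ k ∈ Finset.range m, ∑ ω ∈ W k y y', T ω U (deltaY y' (E : 𝔸)) y‖ := by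
  set a := CkY x 𝔏 𝔢 U (deltaY y' (E : 𝔸)) y
  set s := ∑ k ∈ Finset.range m, ∑ ω ∈ W k y y', T ω U (deltaY y' (E : 𝔸)) y
  have hs : ‖s‖ ≤ ∑ k ∈ Finset.range m, ∑ ω ∈ W k y y', |𝔴.EC.kterm U ω y y'| :=
    (norm_sum_le _ _).trans (Finset.sum_le_sum fun k _ => (norm_sum_le _ _).trans (Finset.sum_le_sum fun ω _ => hT ω y y' E))
  calc ‖a‖ = ‖s + (a - s)‖ := by rw [add_sub_cancel]
    _ ≤ ‖s‖ + ‖a - s‖ := norm_add_le _ _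
    _ ≤ _ := add_le_add_left hs _

variable (x 𝔏 𝔢 𝔴) in
/-- ★★ **(O2″) ⇒ THE READING**: if the operator-valued walk terms are read by the letter's `kterm` (`KTermReadsY`) and the expansion converges kernelwise to
`C^{(k)}(Λ; U)` on Λ (`KExpansionReadsY`), then the kernel of `C^{(k)}(Λ; U)` (def-Y's `siteKernelOfOp … id id` reading) is DOMINATED by the partial sums
of the `|kterm|` — the `hread` binder of `B9Thm315WholeSectE`. [cite: Balaban1985BackgroundPropagators, Thm 3.15 p.432, Thm 3.9 (3.98)–(3.99) p.413] -/
theorem kernelDominated_of_kExpansionReads (hT : KTermReadsY 𝔴 T U) (hE : KExpansionReadsY x 𝔏 𝔢 𝔴 T W U) :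
    KernelDominated 𝔴.EC (siteKernelOfOp x.toKIdx (bg9Y 𝔸 G x) (fun U => U) (CkY x 𝔏 𝔢) id id) (inΛY x) W U := by
  intro y y' hy hy' b hb
  have hb0 : 0 ≤ b := le_trans (by simp) (hb 0)
  -- every direction is bounded by `b`
  have hE' : ∀ E : BallY 𝔸, ‖CkY x 𝔏 𝔢 U (deltaY y' (E : 𝔸)) y‖ ≤ b := fun E => by
    refine le_of_forall_pos_le_add fun ε hε => ?_
    obtain ⟨m₀, hm₀⟩ := hE y y' hy hy' E ε hε
    calc ‖CkY x 𝔏 𝔢 U (deltaY y' (E : 𝔸)) y‖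
        ≤ (∑ k ∈ Finset.range m₀, ∑ ω ∈ W k y y', |𝔴.EC.kterm U ω y y'|) +
            ‖CkY x 𝔏 𝔢 U (deltaY y' (E : 𝔸)) y - ∑ k ∈ Finset.range m₀, ∑ ω ∈ W k y y', T ω U (deltaY y' (E : 𝔸)) y‖ :=
          norm_CkY_deltaY_le hT y y' E m₀
      _ ≤ b + ε := add_le_add (hb m₀) (hm₀ m₀ le_rfl)
  show |⨆ E : BallY 𝔸, ‖CkY x 𝔏 𝔢 U (deltaY y' (E : 𝔸)) y‖| ≤ b
  rw [abs_of_nonneg (Real.iSup_nonneg fun E => norm_nonneg _)]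
  exact iSup_ball_le hE' hb0

/-- ★ **THE `hread` BINDER OF THE SEAT'S ROW-24 FACES IN THE SUPPLIER'S CURRENCY**: at every member and every `U` where the walk letter converges, an
operator-valued walk-term family read by `kterm` with the eventual kernelwise identity (O2″) — gives the `hread` hypothesis of
`B9Thm315WholeSectE.thm315FullPrinted_sectE_of_reading` (and of its record faces, by `rfl`). [cite: Balaban1985BackgroundPropagators, Thm 3.15 p.432, Thm 3.9 (3.98)–(3.99) p.413] -/
theorem hread_of_kExpansionReads (𝔏 : ∀ x : MemberY d ℓ hd hL b₀ b₁ Mstar, CovLettersY 𝔸 x)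
    (𝔢 : ∀ x : MemberY d ℓ hd hL b₀ b₁ Mstar, SectELettersY 𝔸 x) (𝔴 : ∀ x : MemberY d ℓ hd hL b₀ b₁ Mstar, RWLettersEY 𝔸 G x)
    (T : ∀ x : MemberY d ℓ hd hL b₀ b₁ Mstar, (𝔴 x).EC.Walk → IBondOpY 𝔸 x.toKIdx)
    (W : ∀ x : MemberY d ℓ hd hL b₀ b₁ Mstar, ℕ → (geo9Y x).Site → (geo9Y x).Site → Finset (𝔴 x).EC.Walk)
    (h : ∀ (x : MemberY d ℓ hd hL b₀ b₁ Mstar) (U : (bg9Y 𝔸 G x).Cfg), (𝔴 x).EC.Converges U →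
      KTermReadsY (𝔴 x) (T x) U ∧ KExpansionReadsY x (𝔏 x) (𝔢 x) (𝔴 x) (T x) (W x) U) :
    ∀ (x : MemberY d ℓ hd hL b₀ b₁ Mstar) (U : (bg9Y 𝔸 G x).Cfg), (𝔴 x).EC.Converges U →
      KernelDominated (𝔴 x).EC (siteKernelOfOp x.toKIdx (bg9Y 𝔸 G x) (fun U => U) (CkY x (𝔏 x) (𝔢 x)) id id) (inΛY x) (W x) U :=
  fun x U hU => kernelDominated_of_kExpansionReads x (𝔏 x) (𝔢 x) (𝔴 x) (h x U hU).1 (h x U hU).2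

end Reading

end Literature.MathematicalPhysics.QuantumFieldTheory.Balaban1983to89.B9Thm315WholeSectEExpansion

end
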